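import Summits.BirchSwinnertonDyer.BirchSwinnertonDyer.Theorems.ErratumRoadFiveNonSurjCornerMuTransferMult
import Summits.BirchSwinnertonDyer.Rank1Residual.X11a.MuLambdaSplit
import Summits.BirchSwinnertonDyer.Rank1Residual.X11a.Cells
import Literature.NumberTheory.EllipticCurves.Rank1Residual.MuLambdaCarriers
import Literature.NumberTheory.EllipticCurves.IwasawaModuleFinitePadicIntProofs
import Literature.NumberTheory.EllipticCurves.KatoFineSelmerDualMuProofs
import Literature.NumberTheory.EllipticCurves.KatoRankBoundProofs
import Literature.NumberTheory.EllipticCurves.LeadingTermPPartProofs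
import Literature.NumberTheory.EllipticCurves.PAdicBSDSplitMultiplicativeProofs
import Literature.NumberTheory.EllipticCurves.PAdicLFunctionNonsplitMultiplicativeExistenceProofs
import Literature.NumberTheory.EllipticCurves.PAdicLFunctionMultiplicativeInterpolation
import Literature.NumberTheory.EllipticCurves.TateModuleFreeProofs
import HarnessLib

/-!
# An analytic `μ = 0` certificate at a non-surjective multiplicative pair gives Coates–Sujatha's statement (A) at the pair
# (Theses-free part 1 of the ROAD DOMINANCE for the cruxes `PrintX11a.UpperNonSurjFive` stmt-BirchSwinnertonDyer-20614 ∕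
# `…Three` …-20613: the μ-road's input implies the (A)-road's input)

Seat `bsd-line-x11a-p3` (LEAD of line «finemu5»); helper `--supports stmt-BirchSwinnertonDyer-20614`.  Theorems only; no
definition, no named fact, no `sorry`; CONDITIONAL on the displayed facts; nothing is asserted about any curve;
Theses-free (no route file in the import cone); PARTITION 0; BSD is not proved by any of this.

WHY.  Lines «finemu5» ∕ «finemu3» register TWO roads to the same crux with two OPEN inputs: the (A)-road
(`stub_conjA_{five,three}` = statement (A) on the domain) and the μ-road (`stub_muAnHard{Five,Three}` = the analytic
`μ = 0` certificate on the hard sub-locus).  This file proves, per pair, that the analytic certificate implies statement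
(A); part 2 (`Theorems/PrintX11aUpperNonSurjFiveMuRoadGivesConjA.lean`) draws the line-level consequence
`stub_muAnHardFive ⟹ stub_conjA_five`.  Per pair: every landed analytic `μ`-record of the cell (MuCoset, UnitValue,
HardLocusFive, the ty2 `μ`-table doors) certifies (A) at its pair in the kernel, with no class-group computation.

HOW.  §1 `X11b.MultMu.finite_fineSelmerInfty_pTorsion_of_multFine` EXPOSES the hidden intermediate of the landed transfer
`X11b.MultMu.mu_eq_zero_of_multFine` (cell bsd-stepL): one `p`-adic unit coefficient of the Néron-normalised `ϖ·L` at an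
odd multiplicative pair with `E[p]` irreducible and `ρ̄` not onto ⟹ (Cor. 18: `ϖ·L = ι G₁`; certificate: `G₁ ∉ (p)`; p. 280
image + Thm. 12.6 span clauses of F1-mult: a GENUINE `Λ`-adic Euler-system class outside `p𝐇¹`; the reduction-free core
`CoreAssembly.coreOdd_anyReduction_holds`: a power of `T` kills the `E[p]`-lifts) `Sel₀(ℚ_∞, E[p^∞])[p]` is FINITE, for
the cyclotomic datum matching the cyclotomic variable.  §2 that finiteness depends on `κ` only through `ker κ`
(`fineSelmerInfty` is Greenberg's strict Selmer group over the top field), so it transports to EVERY cyclotomic `κ`, and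
Nakayama for duals (`FineSelmerDualData.module_finite_of_finite_pTorsion`, `finite_quotient_augIdealP_of_finite_pTorsion`,
`IwasawaModuleFinitePadicInt.moduleFinite_padicInt_of_finite_quotient_augIdealP`) makes the pinned dual fine datum finitely
generated over `ℤ_p`: `ConjAAt W p`.  §3 the certificate-shape doors (`conjAAt_of_muAnCert`, `conjAAt_of_muAnZeroAt`,
`ClassX11a.conjAAt_of_muAnZeroAt_of_not_surj`) and the hard-locus form `ClassX11a.conjAAt_of_muAnHard_of_not_surj` whose
complement (non-split, unit `L(E,1)/Ω_E`) supplies its own unit coefficient `[T⁰](ϖ·L) = 2·L(E,1)/Ω_E`.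

References: [Kato2004Asterisque] Thm. 12.6 (p. 222), (14.9.3) (p. 240), §17.13 (pp. 279–280); [Wuthrich2014] p. 391,
Cor. 18 (p. 398); [CoatesSujatha2005] §3 statement (A); [GreenbergLNM1716] §1 p. 60, Conj. 1.11, §4 (p. 113);
[MazurTateTeitelbaum1986] §I.10; [Washington1997] §13.1–13.2; tree `Theorems/ErratumRoadFiveNonSurjCornerMuTransferMult.lean`,
`X11a/MuLambdaSplit.lean`, `Rank1Residual/MuLambdaCarriers.lean`, `KatoFineSelmerDualMuProofs.lean`, `IwasawaModuleFinitePadicIntProofs.lean`.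
-/

set_option autoImplicit false

noncomputable section

open scoped Classical NumberField MatrixGroups ModularForm
open CongruenceSubgroup WeierstrassCurve NumberField IsDedekindDomain Field
open Literature.NumberTheory.GaloisRepresentations
open Literature.NumberTheory.GaloisCohomology
open Literature.NumberTheory.EllipticCurves Literature.NumberTheory.EllipticCurves.ModularForms
open Literature.NumberTheory.EllipticCurves.Kato2004 Literature.NumberTheory.EllipticCurves.Kato2004.EulerSystemValues
open Literature.NumberTheory.EllipticCurves.Rank1Residual
open Summit.BirchSwinnertonDyer.BirchSwinnertonDyer.Rank1Residual

/-! ### §1 The hidden intermediate of the μ-transfer: a unit coefficient ⟹ `Sel₀(ℚ_∞, E[p^∞])[p]` finite -/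

namespace Summit.BirchSwinnertonDyer.Rank1Residual.X11b.MultMu

/-- **One unit coefficient of `ϖ·L` ⟹ `Sel₀(ℚ_∞, E[p^∞])[p]` is FINITE** at an ODD prime of MULTIPLICATIVE reduction with
`E[p]` irreducible and `ρ̄_{E,p}` not onto, for every cyclotomic datum `(κ, γ)` matching the cyclotomic variable — the
intermediate of `mu_eq_zero_of_multFine` (same proof up to the core), exposed: Cor. 18 puts `ϖ·L = ι G₁` in `Λ`, the
certificate gives `G₁ ∉ (p)`, the p. 280 image and Thm. 12.6 span clauses of F1-mult give a genuine `Λ`-adic Euler-system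
class outside `p𝐇¹`, and the reduction-free core (`CoreAssembly.coreOdd_anyReduction_holds`) kills the `E[p]`-lifts of
`Sel₀` by a power of `T`, whence finiteness (`finite_fineSelmerInfty_pTorsion_of_forall_iterate_eq_zero`).
[cite: Kato2004Asterisque, Thm. 12.6 (p. 222) and §17.13 (pp. 279–280)] [cite: Wuthrich2014, p. 391 and Cor. 18 (p. 398)]
[cite: GreenbergLNM1716, §1 p. 60] -/
theorem finite_fineSelmerInfty_pTorsion_of_multFine (hfine : exists_multDivisibilityInputs_fine)
    (h18 : Wuthrich2014.corollary18_padicLFunction_mem_iwasawaAlgebra_multiplicative)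
    (W : WeierstrassCurve ℚ) [W.IsElliptic] [W.IsGloballyMinimal] (p : ℕ) [Fact p.Prime]
    {N : ℕ} [NeZero N] (f : CuspForm (Gamma0 N) 2)
    (hp2 : p ≠ 2) (hmult : W.HasMultiplicativeReductionAtPrime p)
    (hirr : W.HasIrreducibleModPGaloisRep p) (hnsurj : ¬ W.HasSurjectiveModNGaloisRep p) (hf : IsNewformOf W f)
    (ϖ : ℚ) (hϖ : (ϖ : ℝ) * W.realPeriodRat = plusPeriod f)
    (a : ℚ_[p]) (L : PowerSeries ℚ_[p])
    (hsa : W.HasSplitMultiplicativeReductionAtPrime p → a = 1)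
    (hna : ¬ W.HasSplitMultiplicativeReductionAtPrime p → a = -1)
    (hL : IsMultPAdicLFunctionOf f p a L)
    (hcert : ∃ n : ℕ, ‖PowerSeries.coeff n (PowerSeries.C ((ϖ : ℚ) : ℚ_[p]) * L)‖ = 1)
    (κ : ZpExtension ℚ p) (γ : absoluteGaloisGroup ℚ)
    (hκ : κ.IsCyclotomic) (hγ : κ.IsTopGenerator γ) (hγ' : IsCyclotomicVariable p γ) :
    Set.Finite {s : W.fineSelmerInfty κ | p • s = 0} := by
  haveI : ContinuousSMul ℤ_[p] (W.tateModule p) := TateModule.continuousSMul_padicInt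
  haveI : Module.Free ℤ_[p] (W.tateModule p) := W.module_free_tateModule_holds p
  haveI : Module.Finite ℤ_[p] (W.tateModule p) := W.module_finite_tateModule_holds p
  -- the pinned modules: `𝐇¹_Γ(T_pW)`, `X(E/ℚ_∞)` and the dual fine Selmer group `X₀(E/ℚ_∞)`
  obtain ⟨I⟩ := nonempty_iwasawaH1Data_holds W p κ γ hκ hγ
  obtain ⟨D⟩ := W.nonempty_selmerDualData_holds κ γ hγ
  obtain ⟨Y⟩ := W.nonempty_fineSelmerDualData κ hγ
  -- Kato's package at the multiplicative prime, with the span and the image clauses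
  obtain ⟨K, -, -, -, -, hZ, himg⟩ := hfine W p f κ γ hp2 hmult hκ hγ hγ' hf a L hsa hna hL I D Y
  -- `ϖ·L ∈ Λ` (Wuthrich 2014 Cor. 18) and the certificate: `G₁ ∉ (p)`
  obtain ⟨G₁, hG₁⟩ : ∃ G₁ : IwasawaAlgebra p,
      iwasawaToPowerSeries p G₁ = PowerSeries.C ((ϖ : ℚ) : ℚ_[p]) * L := by
    obtain ⟨hns, hs⟩ := h18 W p hp2 hmult hf ϖ hϖ
    by_cases hsplit : W.HasSplitMultiplicativeReductionAtPrime p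
    · have ha : a = 1 := hsa hsplit
      subst ha
      exact hs hsplit L ((isMultPAdicLFunctionOf_one_iff L).mp hL)
    · have ha : a = -1 := hna hsplit
      subst ha
      exact hns hsplit L hL
  have hμL : G₁ ∉ IwasawaAlgebra.augIdealP p := not_mem_augIdealP_of_norm_coeff_eq_one hG₁ hcert
  let 𝔭 : PrimeSpectrum (IwasawaAlgebra p) :=
    ⟨IwasawaAlgebra.augIdealP p, IwasawaAlgebra.isPrime_augIdealP_holds p⟩
  have himg𝔭 : ∃ s : IwasawaAlgebra p, s ∉ IwasawaAlgebra.augIdealP p ∧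
      s * G₁ ∈ Submodule.map (K.col ∘ₗ K.loc) K.Z := by
    obtain ⟨s, hs, hsG, -⟩ :=
      himg hirr G₁ ϖ hϖ hG₁ 𝔭 (by exact IwasawaAlgebra.height_augIdealP_holds p)
    exact ⟨s, hs, hsG⟩
  -- a GENUINE Euler-system class not divisible by `p`, then the reduction-free core
  obtain ⟨s, hs, hsp⟩ := exists_isEulerSystemClass_not_mem_of_mult K hZ hμL himg𝔭
  obtain ⟨J, hJ⟩ := CoreAssembly.coreOdd_anyReduction_holds W p κ γ I hp2 hirr
    (by exact_mod_cast hnsurj) hκ hγ ⟨s, hs, hsp⟩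
  exact W.finite_fineSelmerInfty_pTorsion_of_forall_iterate_eq_zero κ hγ hJ

end Summit.BirchSwinnertonDyer.Rank1Residual.X11b.MultMu

/-! ### §2 Transport across cyclotomic data and statement (A) -/

namespace Summit.BirchSwinnertonDyer.Rank1Residual.X11b.MuRoadConjA

variable {p : ℕ} [Fact p.Prime] {W : WeierstrassCurve ℚ} [W.IsElliptic]

omit [W.IsElliptic] in
/-- **`Sel₀(K_∞, E[p^∞])[p]` depends on `κ` only through `ker κ`**: the fine Selmer group is Greenberg's strict Selmer
group over the top field `K_∞ = K̄^{ker κ}`, so finiteness of its `p`-torsion transports between `ℤ_p`-extensions with the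
same kernel (e.g. two cyclotomic ones, `ZpExtension.IsCyclotomic`). [cite: Greenberg1989, §1 p. 98] [cite: Washington1997, §13.1] -/
theorem finite_pTorsion_fineSelmerInfty_of_kerSubgroup_eq [W.IsElliptic] {κ κ' : ZpExtension ℚ p}
    (h : κ.kerSubgroup = κ'.kerSubgroup) (hfin : Set.Finite {s : W.fineSelmerInfty κ | p • s = 0}) :
    Set.Finite {s : W.fineSelmerInfty κ' | p • s = 0} := by
  have key : ∀ (H H' : Subgroup (absoluteGaloisGroup ℚ)) [H.Normal] [H'.Normal], H = H' →
      Set.Finite {s : GreenbergSelmer.strictSelmerGroupOver H (W.geomPrimaryTorsion p) p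
        (GreenbergSelmer.fineData (W.geomPrimaryTorsion p) p) | p • s = 0} →
      Set.Finite {s : GreenbergSelmer.strictSelmerGroupOver H' (W.geomPrimaryTorsion p) p
        (GreenbergSelmer.fineData (W.geomPrimaryTorsion p) p) | p • s = 0} := by
    intro H H' _ _ hHH' hH
    subst hHH'
    exact hH
  exact key κ.kerSubgroup κ'.kerSubgroup h hfin

/-- Two cyclotomic `ℤ_p`-extension data of `ℚ` have the same kernel (both are the preimage of the torsion of `ℤ_p^×`
under the cyclotomic character). [cite: Washington1997, §13.1] -/
theorem kerSubgroup_eq_of_isCyclotomic {κ κ' : ZpExtension ℚ p} (hκ : κ.IsCyclotomic) (hκ' : κ'.IsCyclotomic) :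
    κ.kerSubgroup = κ'.kerSubgroup :=
  (show κ.kerSubgroup = _ from hκ).trans (show κ'.kerSubgroup = _ from hκ').symm

/-- **`Sel₀(ℚ_∞, E[p^∞])[p]` finite for ONE cyclotomic datum ⟹ statement (A) at the pair** (`ConjAAt W p`): transport
to every cyclotomic `κ` (same kernel), then Nakayama for duals — the pinned dual fine datum `X₀` is finitely generated
over `Λ` (`module_finite_of_finite_pTorsion`), `X₀/pX₀` is finite (`finite_quotient_augIdealP_of_finite_pTorsion`), hence
`X₀` is finitely generated over `ℤ_p` (`moduleFinite_padicInt_of_finite_quotient_augIdealP`).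
[cite: CoatesSujatha2005, §3 statement (A)] [cite: GreenbergLNM1716, §1 p. 60] [cite: Washington1997, §13.2] -/
theorem conjAAt_of_finite_pTorsion_fineSelmerInfty {κ₀ : ZpExtension ℚ p} (hκ₀ : κ₀.IsCyclotomic)
    (hfin : Set.Finite {s : W.fineSelmerInfty κ₀ | p • s = 0}) : ConjAAt W p := by
  intro κ hκ
  have hfinκ : Set.Finite {s : W.fineSelmerInfty κ | p • s = 0} :=
    finite_pTorsion_fineSelmerInfty_of_kerSubgroup_eq (kerSubgroup_eq_of_isCyclotomic hκ₀ hκ) hfin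
  obtain ⟨γ, hγ⟩ : ∃ γ : absoluteGaloisGroup ℚ, κ.IsTopGenerator γ := κ.surjective (Multiplicative.ofAdd 1)
  let Y : W.FineSelmerDualData κ γ := W.fineSelmerDualData κ hγ
  haveI : Module.Finite (IwasawaAlgebra p) Y.X := Y.module_finite_of_finite_pTorsion hγ hfinκ
  exact ⟨γ, Y, IwasawaModuleFinitePadicInt.moduleFinite_padicInt_of_finite_quotient_augIdealP p Y.X
    (Y.finite_quotient_augIdealP_of_finite_pTorsion hfinκ)⟩

/-- **The analytic certificate (for every newform ∕ period ratio ∕ MTT function, SOME unit coefficient of `ϖ·L`) ⟹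
statement (A) at the pair**, for `W` globally minimal, `p` an ODD prime of MULTIPLICATIVE reduction, `E[p]` irreducible,
`ρ̄` NOT onto — modulo F1-mult (`hfine`), Wuthrich 2014 Cor. 18 (`h18`) and the modular-parametrisation supply (`hpar`,
for one newform and the rational period ratio).  Used at the standard cyclotomic datum of
`exists_isCyclotomic_isTopGenerator_isCyclotomicVariable_holds`, then §1 and `conjAAt_of_finite_pTorsion_fineSelmerInfty`.
[cite: Kato2004Asterisque, Thm. 12.6 (p. 222) and §17.13 (pp. 279–280)] [cite: Wuthrich2014, Cor. 18 (p. 398)]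
[cite: CoatesSujatha2005, §3 statement (A)] [cite: GreenbergLNM1716, §1 p. 60 and Conj. 1.11] -/
theorem conjAAt_of_muAnCert [W.IsGloballyMinimal] (hfine : exists_multDivisibilityInputs_fine)
    (h18 : Wuthrich2014.corollary18_padicLFunction_mem_iwasawaAlgebra_multiplicative)
    (hpar : nonempty_modularParametrizationData)
    (hp2 : p ≠ 2) (hmult : W.HasMultiplicativeReductionAtPrime p) (hirr : W.HasIrreducibleModPGaloisRep p)
    (hnsurj : ¬ W.HasSurjectiveModNGaloisRep p)
    (hAn : ∀ {N : ℕ} [NeZero N] (f : CuspForm (Gamma0 N) 2), IsNewformOf W f →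
      ∀ (ϖ : ℚ), (ϖ : ℝ) * W.realPeriodRat = plusPeriod f →
      ∀ (a : ℚ_[p]) (L : PowerSeries ℚ_[p]),
        (W.HasSplitMultiplicativeReductionAtPrime p → a = 1) →
        (¬ W.HasSplitMultiplicativeReductionAtPrime p → a = -1) →
        IsMultPAdicLFunctionOf f p a L →
        ∃ n : ℕ, ‖PowerSeries.coeff n (PowerSeries.C ((ϖ : ℚ) : ℚ_[p]) * L)‖ = 1) :
    ConjAAt W p := by
  obtain ⟨κ₀, hκ₀, γ₀, hγ₀, hγ₀'⟩ := exists_isCyclotomic_isTopGenerator_isCyclotomicVariable_holds p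
  haveI : NeZero (W.conductorNorm ℤ) := ⟨(W.conductorNorm_pos_holds).ne'⟩
  obtain ⟨Dm⟩ := hpar W
  obtain ⟨ϖ, -, hϖ, -⟩ := Dm.exists_rat_mul_realPeriodRat_eq_plusPeriod
  refine conjAAt_of_finite_pTorsion_fineSelmerInfty hκ₀ ?_
  by_cases hsplit : W.HasSplitMultiplicativeReductionAtPrime p
  · obtain ⟨L, hL⟩ := exists_isSplitMultPAdicLFunctionOf hsplit Dm.isNewformOf
    have hL1 : IsMultPAdicLFunctionOf Dm.f p 1 L := (isMultPAdicLFunctionOf_one_iff L).mpr hL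
    exact MultMu.finite_fineSelmerInfty_pTorsion_of_multFine hfine h18 W p Dm.f hp2 hmult hirr hnsurj Dm.isNewformOf
      ϖ hϖ 1 L (fun _ => rfl) (fun hns => absurd hsplit hns) hL1
      (hAn Dm.f Dm.isNewformOf ϖ hϖ 1 L (fun _ => rfl) (fun hns => absurd hsplit hns) hL1) κ₀ γ₀ hκ₀ hγ₀ hγ₀'
  · obtain ⟨L, hL⟩ := exists_isMultPAdicLFunctionOf_neg_one_of_nonsplit Dm.isNewformOf hmult hsplit
    exact MultMu.finite_fineSelmerInfty_pTorsion_of_multFine hfine h18 W p Dm.f hp2 hmult hirr hnsurj Dm.isNewformOf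
      ϖ hϖ (-1) L (fun hs => absurd hs hsplit) (fun _ => rfl) hL
      (hAn Dm.f Dm.isNewformOf ϖ hϖ (-1) L (fun hs => absurd hs hsplit) (fun _ => rfl) hL) κ₀ γ₀ hκ₀ hγ₀ hγ₀'

/-- **`X11a.MuAnZeroAt W p ⟹ ConjAAt W p`** (the ty2 ∕ lane certificate shape: non-split and split clauses) at an odd
multiplicative pair with `E[p]` irreducible and `ρ̄` not onto, modulo `hfine`, `h18`, `hpar`.
[cite: Kato2004Asterisque, §17.13 (pp. 279–280)] [cite: CoatesSujatha2005, §3 statement (A)] [cite: GreenbergLNM1716, Conj. 1.11] -/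
theorem conjAAt_of_muAnZeroAt [W.IsGloballyMinimal] (hfine : exists_multDivisibilityInputs_fine)
    (h18 : Wuthrich2014.corollary18_padicLFunction_mem_iwasawaAlgebra_multiplicative)
    (hpar : nonempty_modularParametrizationData)
    (hp2 : p ≠ 2) (hmult : W.HasMultiplicativeReductionAtPrime p) (hirr : W.HasIrreducibleModPGaloisRep p)
    (hnsurj : ¬ W.HasSurjectiveModNGaloisRep p) (hμ : X11a.MuAnZeroAt W p) : ConjAAt W p := by
  refine conjAAt_of_muAnCert hfine h18 hpar hp2 hmult hirr hnsurj fun f hf ϖ hϖ a L hsa hna hL => ?_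
  obtain ⟨hAns, hAs⟩ := hμ f hf ϖ hϖ
  by_cases hsplit : W.HasSplitMultiplicativeReductionAtPrime p
  · have ha : a = 1 := hsa hsplit
    subst ha
    exact hAs hsplit L ((isMultPAdicLFunctionOf_one_iff L).mp hL)
  · have ha : a = -1 := hna hsplit
    subst ha
    exact hAns hsplit L hL

/-- **On class X11a**: `ClassX11a W p → ¬ Surj W p → X11a.MuAnZeroAt W p → ConjAAt W p` (modulo `hfine`, `h18`, `hpar`) —
every landed μ-record pair of the cell carries statement (A) in the kernel. [cite: CoatesSujatha2005, §3 statement (A)]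
[cite: Kato2004Asterisque, §17.13 (pp. 279–280)] [cite: GreenbergLNM1716, Conj. 1.11] -/
theorem _root_.Summit.BirchSwinnertonDyer.Rank1Residual.ClassX11a.conjAAt_of_muAnZeroAt_of_not_surj
    [W.IsGloballyMinimal] (hfine : exists_multDivisibilityInputs_fine)
    (h18 : Wuthrich2014.corollary18_padicLFunction_mem_iwasawaAlgebra_multiplicative)
    (hpar : nonempty_modularParametrizationData)
    (hX : ClassX11a W p) (hns : ¬ Surj W p) (hμ : X11a.MuAnZeroAt W p) : ConjAAt W p :=
  conjAAt_of_muAnZeroAt hfine h18 hpar hX.2.1 hX.2.2.1 hX.2.2.2.1 (by exact_mod_cast hns) hμ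


/-- **The hard-locus analytic certificate ∪ the unit special value on its complement ⟹ statement (A)** at a
non-surjective X11a pair (any `p`): on the hard sub-locus {split at `p`} ∪ {`ord_p(L(E,1)/Ω_E) ≠ 0`} the certificate is
the hypothesis `hH` (the shape of `Theorems.X11aNonSurjMuAnHard{Five,Three}` at the pair); off it the pair is NON-split
with `L(E,1)/Ω_E = t`, `ord_p t = 0`, and `[T⁰](ϖ·L) = ϖ·(2·[0]⁺_f) = 2t` (`IsMultPAdicLFunctionOf.constantCoeff_of_neg_one`,
MTT §I.10 at `a_p = −1`) is a `p`-adic unit.  Modulo `hfine`, `h18`, `hpar`, `hmod`.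
[cite: GreenbergLNM1716, §4 (PDF p. 113) and Conj. 1.11] [cite: MazurTateTeitelbaum1986, §I.10]
[cite: CoatesSujatha2005, §3 statement (A)] [cite: Kato2004Asterisque, §17.13 (pp. 279–280)] -/
theorem _root_.Summit.BirchSwinnertonDyer.Rank1Residual.ClassX11a.conjAAt_of_muAnHard_of_not_surj
    [W.IsGloballyMinimal] (hfine : exists_multDivisibilityInputs_fine)
    (h18 : Wuthrich2014.corollary18_padicLFunction_mem_iwasawaAlgebra_multiplicative)
    (hpar : nonempty_modularParametrizationData) (hmod : hasEntireLFunction_rat)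
    (hX : ClassX11a W p) (hns : ¬ Surj W p)
    (hH : (W.HasSplitMultiplicativeReductionAtPrime p ∨
        ∀ t : ℚ, W.entireLFunction 1 / (W.realPeriodRat : ℂ) = (t : ℂ) → padicValRat p t ≠ 0) →
      ∀ {N : ℕ} [NeZero N] (f : CuspForm (Gamma0 N) 2), IsNewformOf W f →
        ∀ (ϖ : ℚ), (ϖ : ℝ) * W.realPeriodRat = plusPeriod f →
        ∀ (a : ℚ_[p]) (L : PowerSeries ℚ_[p]),
          (W.HasSplitMultiplicativeReductionAtPrime p → a = 1) →
          (¬ W.HasSplitMultiplicativeReductionAtPrime p → a = -1) →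
          IsMultPAdicLFunctionOf f p a L →
          ∃ n : ℕ, ‖PowerSeries.coeff n (PowerSeries.C ((ϖ : ℚ) : ℚ_[p]) * L)‖ = 1) :
    ConjAAt W p := by
  have hp2 : p ≠ 2 := hX.2.1
  refine conjAAt_of_muAnCert hfine h18 hpar hp2 hX.2.2.1 hX.2.2.2.1 (by exact_mod_cast hns) ?_
  intro N _ f hf ϖ hϖ a L hsa hna hL
  by_cases hhard : W.HasSplitMultiplicativeReductionAtPrime p ∨
      ∀ t : ℚ, W.entireLFunction 1 / (W.realPeriodRat : ℂ) = (t : ℂ) → padicValRat p t ≠ 0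
  · exact hH hhard f hf ϖ hϖ a L hsa hna hL
  · -- off the hard locus: non-split with a unit special value
    push Not at hhard
    obtain ⟨hnsp, t, ht, hunit⟩ := hhard
    have ha : a = -1 := hna hnsp
    subst ha
    have hL1 : W.entireLFunction 1 ≠ 0 := hX.L_one_ne_zero hmod
    have hΩC : (W.realPeriodRat : ℂ) ≠ 0 := Complex.ofReal_ne_zero.mpr W.realPeriodRat_pos_holds.ne'
    have ht0 : t ≠ 0 := by
      rintro rfl
      apply hL1
      rw [← div_mul_cancel₀ (W.entireLFunction 1) hΩC, ht]
      simp
    -- `ϖ · [0]⁺_f = L(E,1)/Ω_E = t`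
    have hq : W.entireLFunction 1 / (W.realPeriodRat : ℂ) = (((ϖ * ratPlusSymbol f 0 : ℚ)) : ℂ) := by
      rw [hf.entireLFunction_one_eq, ← hϖ, div_eq_iff hΩC]
      push_cast
      ring
    have hteq : ϖ * ratPlusSymbol f 0 = t := by exact_mod_cast (ht.symm.trans hq).symm
    have hne : ϖ * ratPlusSymbol f 0 ≠ 0 := hteq ▸ ht0
    have hval : padicValRat p (ϖ * ratPlusSymbol f 0) = 0 := hteq ▸ hunit
    have hnorm : ‖(((ϖ * ratPlusSymbol f 0 : ℚ)) : ℚ_[p])‖ = 1 := by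
      rw [Padic.eq_padicNorm, padicNorm.eq_zpow_of_nonzero hne, hval, neg_zero, zpow_zero, Rat.cast_one]
    -- `‖2‖_p = 1` (`p` odd)
    have h2 : ‖(2 : ℚ_[p])‖ = 1 := by
      have hle : ‖((2 : ℤ) : ℚ_[p])‖ ≤ 1 := Padic.norm_int_le_one 2
      have hnlt : ¬ ‖((2 : ℤ) : ℚ_[p])‖ < 1 := by
        rw [Padic.norm_intCast_lt_one_iff]
        intro h
        have hp : p ∣ 2 := by exact_mod_cast h
        exact hp2 ((Nat.prime_dvd_prime_iff_eq (Fact.out) Nat.prime_two).mp hp)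
      have h2z : ((2 : ℤ) : ℚ_[p]) = (2 : ℚ_[p]) := by norm_num
      rw [h2z] at hle hnlt
      exact le_antisymm hle (not_lt.mp hnlt)
    refine ⟨0, ?_⟩
    rw [PowerSeries.coeff_C_mul, PowerSeries.coeff_zero_eq_constantCoeff_apply, hL.constantCoeff_of_neg_one,
      mul_left_comm, norm_mul, h2, one_mul, ← Rat.cast_mul, hnorm]

end Summit.BirchSwinnertonDyer.Rank1Residual.X11b.MuRoadConjA

end
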